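import Summits.KontsevichZagierPeriods.KontsevichZagierPeriods.Theorems.RootDecompRelativeModAbsoluteCylLogSplitP50

/-! # `RootDecompRelativeModAbsoluteCylLogSplitP51` — part 26/27 of the mechanical ≤400-line split of `RungClosure.lean` (sha256 f909f334226f0fb5…)
Source: decomp-kz lens-3 g12 `RungClosure.lean` v9 (HOME/decomp-kz-lens-3/g12/, sha256 f909f334…; critic g4-52/g4-57/g5 CLEARED, «lander: split v9 --supports 30572»): BLOCK I (57 g11 monolith decls missing from P01–P25), BLOCK II/III (WildCertAssembly parts 1–6, 8–10: `Leaf.cellLocalWildCert`, `Leaf.cylKernelZeroLog_of_trees`), Parts 12–13 (`Leaf.regKernelPairDegOne_iff_circlePos_of_trees`), BLOCK G13 (Möbius engine, test §C decided).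
Split by census-1 g9 `gen/splitlean.py`: scopes re-opened with their `open`/`variable`/`set_option` context; mathematics and declaration order unchanged. -/

noncomputable section
open MeasureTheory Set
open Literature.NumberTheory.Transcendental Literature.ModelTheory.ExponentialFields
namespace Summit.KontsevichZagierPeriods.RootDecompRelativeModAbsolute.Rung30571.RegularisedLogLayer.CylLog.Leaf.G13
namespace TestC
open DegenerateInstance

/-- `Tc = [band G 0 1, f₁ + f₂ + f₃]` (the test integrand on the CLOSED band). -/
def Tc : KZ.IntegralRep (1 + 1) :=
  bandRep (fun _ => 0) (fun _ => 1) (fun z => f₁ z + (f₂ z + f₃ z)) sa_zero sa_one le0 le1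
    (IsSemialgebraicFunOn.add_holds (sa_kernelC (band_sa sa_zero sa_one) band_sub sa_u sa_usq fun _ _ => sq_nonneg _)
      (IsSemialgebraicFunOn.add_holds
        (sa_kernelC (band_sa sa_zero sa_one) band_sub sa_inv_u sa_invusq fun _ _ => sq_nonneg _)
        (sa_kernelC (band_sa sa_zero sa_one) band_sub sa_m2 sa_one fun _ _ => zero_le_one)))
    5 fun z hz => by
      have hy := hz.1
      have h1 : |f₁ z| ≤ 2 := (abs_kernelC_le (sq_nonneg _)).trans (by rw [abs_of_pos (u_pos hy)]; exact leu _ hy)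
      have h2 : |f₂ z| ≤ 1 := (abs_kernelC_le (sq_nonneg _)).trans (by
        have := one_lt_u hy
        rw [abs_of_pos (by have := u_pos hy; positivity), div_le_one (by linarith)]; linarith)
      have h3 : |f₃ z| ≤ 2 := (abs_kernelC_le zero_le_one).trans (by norm_num)
      calc |f₁ z + (f₂ z + f₃ z)| ≤ |f₁ z| + (|f₂ z| + |f₃ z|) :=
            (abs_add_le _ _).trans (add_le_add le_rfl (abs_add_le _ _))
        _ ≤ 5 := by linarith
/-- Auxiliary definition `T1`: T1. [bookkeeping] -/
def T1 : KZ.IntegralRep (1 + 1) :=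
  bandRep (fun _ => 0) (fun _ => 1) f₁ sa_zero sa_one le0 le1
    (sa_kernelC (band_sa sa_zero sa_one) band_sub sa_u sa_usq fun _ _ => sq_nonneg _) 2 fun z hz =>
      (abs_kernelC_le (sq_nonneg _)).trans (by rw [abs_of_pos (u_pos hz.1)]; exact leu _ hz.1)
/-- Auxiliary definition `T23`: T23. [bookkeeping] -/
def T23 : KZ.IntegralRep (1 + 1) :=
  bandRep (fun _ => 0) (fun _ => 1) (fun z => f₂ z + f₃ z) sa_zero sa_one le0 le1
    (IsSemialgebraicFunOn.add_holds
      (sa_kernelC (band_sa sa_zero sa_one) band_sub sa_inv_u sa_invusq fun _ _ => sq_nonneg _)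
      (sa_kernelC (band_sa sa_zero sa_one) band_sub sa_m2 sa_one fun _ _ => zero_le_one)) 3 fun z hz => by
      have hy := hz.1
      have h2 : |f₂ z| ≤ 1 := (abs_kernelC_le (sq_nonneg _)).trans (by
        have := one_lt_u hy
        rw [abs_of_pos (by have := u_pos hy; positivity), div_le_one (by linarith)]; linarith)
      have h3 : |f₃ z| ≤ 2 := (abs_kernelC_le zero_le_one).trans (by norm_num)
      exact (abs_add_le _ _).trans (by linarith)
/-- Auxiliary definition `T2`: T2. [bookkeeping] -/
def T2 : KZ.IntegralRep (1 + 1) :=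
  bandRep (fun _ => 0) (fun _ => 1) f₂ sa_zero sa_one le0 le1
    (sa_kernelC (band_sa sa_zero sa_one) band_sub sa_inv_u sa_invusq fun _ _ => sq_nonneg _) 1 fun z hz =>
      (abs_kernelC_le (sq_nonneg _)).trans (by
        have := one_lt_u hz.1
        rw [abs_of_pos (by have := u_pos hz.1; positivity), div_le_one (by linarith)]; linarith)
/-- Auxiliary definition `T3`: T3. [bookkeeping] -/
def T3 : KZ.IntegralRep (1 + 1) :=
  bandRep (fun _ => 0) (fun _ => 1) f₃ sa_zero sa_one le0 le1
    (sa_kernelC (band_sa sa_zero sa_one) band_sub sa_m2 sa_one fun _ _ => zero_le_one) 2 fun _ _ =>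
      (abs_kernelC_le zero_le_one).trans (by norm_num)
/-- arctangent monomials `[{0 ≤ t ≤ b}, dt/(1+t²)]` for `b = u, 1/u, 1`, the negative one, and the two bands
`B = [{1 ≤ t ≤ u}]`, `B' = [{1/u ≤ s ≤ 1}]`. -/
def Au : KZ.IntegralRep (1 + 1) :=
  bandRep (fun _ => 0) u gA sa_zero sa_u le0 leu (sa_kernelA (band_sa sa_zero sa_u) band_sub sa_one) 1
    fun _ _ => abs_kernelA_le.trans (by norm_num)
/-- Auxiliary definition `Ainv`: Ainv. [bookkeeping] -/
def Ainv : KZ.IntegralRep (1 + 1) :=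
  bandRep (fun _ => 0) (fun y => 1 / u y) gA sa_zero sa_inv_u le0 leinv2
    (sa_kernelA (band_sa sa_zero sa_inv_u) band_sub sa_one) 1 fun _ _ => abs_kernelA_le.trans (by norm_num)
/-- Auxiliary definition `A1`: A1. [bookkeeping] -/
def A1 : KZ.IntegralRep (1 + 1) :=
  bandRep (fun _ => 0) (fun _ => 1) gA sa_zero sa_one le0 le1 (sa_kernelA (band_sa sa_zero sa_one) band_sub sa_one) 1
    fun _ _ => abs_kernelA_le.trans (by norm_num)
/-- Auxiliary definition `A1neg`: A1neg. [bookkeeping] -/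
def A1neg : KZ.IntegralRep (1 + 1) :=
  bandRep (fun _ => 0) (fun _ => 1) gN sa_zero sa_one le0 le1 (sa_kernelA (band_sa sa_zero sa_one) band_sub sa_m1) 1
    fun _ _ => abs_kernelA_le.trans (by norm_num)
/-- Auxiliary definition `B`: B. [bookkeeping] -/
def B : KZ.IntegralRep (1 + 1) :=
  bandRep (fun _ => 1) u gA sa_one sa_u le1' leu (sa_kernelA (band_sa sa_one sa_u) band_sub sa_one) 1
    fun _ _ => abs_kernelA_le.trans (by norm_num)
/-- Auxiliary definition `B'`: B'. [bookkeeping] -/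
def B' : KZ.IntegralRep (1 + 1) :=
  bandRep (fun y => 1 / u y) (fun _ => 1) gA sa_inv_u sa_one leinv0 le1
    (sa_kernelA (band_sa sa_inv_u sa_one) band_sub sa_one) 1 fun _ _ => abs_kernelA_le.trans (by norm_num)

/-! ### the data in the shape of `CylKernelZeroCirclePos` and the open box -/

/-- Auxiliary definition `a₀C`: a₀C. [bookkeeping] -/
def a₀C : (Fin 1 → ℝ) → ℝ := fun _ => 0
/-- Auxiliary definition `cC`: c C. [bookkeeping] -/
def cC : Fin 3 → (Fin 1 → ℝ) → ℝ := ![u, fun y => 1 / u y, fun _ => -2]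
/-- Auxiliary definition `κC`: κC. [bookkeeping] -/
def κC : Fin 3 → (Fin 1 → ℝ) → ℝ := ![fun y => u y ^ 2, fun y => (1 / u y) ^ 2, fun _ => 1]
/-- Auxiliary definition `MC`: MC. [bookkeeping] -/
def MC : Fin 3 → ℕ := fun _ => 0
/-- Auxiliary definition `eC`: e C. [bookkeeping] -/
def eC : Fin 3 → ℕ := fun _ => 2
/-- the test integrand in the literal shape of the residual `CylKernelZeroCirclePos` -/
def FC (z : Fin (1 + 1) → ℝ) : ℝ :=
  a₀C (Fin.init z) + ∑ i, cC i (Fin.init z) * (z (Fin.last 1) ^ MC i / (1 + z (Fin.last 1) ^ eC i * κC i (Fin.init z)))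

/-- Auxiliary step `FC_eq`: FC eq. [bookkeeping] -/
theorem FC_eq (z : Fin (1 + 1) → ℝ) : FC z = f₁ z + (f₂ z + f₃ z) := by
  simp only [FC, Fin.sum_univ_three, a₀C, cC, κC, MC, eC, Matrix.cons_val_zero, Matrix.cons_val_one,
    Matrix.head_cons, Matrix.cons_val_two, Matrix.tail_cons, pow_zero, f₁, f₂, f₃, zero_add]
  ring

/-- the open box `G × (0,1)` -/
def box : Set (Fin (1 + 1) → ℝ) := {z | (Fin.init z : Fin 1 → ℝ) ∈ G ∧ z (Fin.last 1) ∈ Ioo (0:ℝ) 1}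
/-- Auxiliary step `isSemialgebraic_box`: is Semialgebraic box. [bookkeeping] -/
theorem isSemialgebraic_box : IsSemialgebraic ℚ box := RTerm.isSemialgebraic_cyl isSemialgebraic_G
/-- Auxiliary step `box_subset`: box subset. [bookkeeping] -/
theorem box_subset : box ⊆ Tc.domain := fun _ hz => ⟨hz.1, hz.2.1.le, hz.2.2.le⟩
/-- Auxiliary step `volume_Tc_diff_box`: volume Tc diff box. [bookkeeping] -/
theorem volume_Tc_diff_box : volume (Tc.domain \ box) = 0 := by
  refine measure_mono_null (fun z hz => ?_)
    (measure_union_null (KZ.volume_setOf_last_eq_zero (n := 1) 0) (KZ.volume_setOf_last_eq_zero (n := 1) 1))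
  obtain ⟨⟨hy, h0, h1⟩, hnot⟩ := hz
  have hnot' : ¬ (0 < z (Fin.last 1) ∧ z (Fin.last 1) < 1) := fun h => hnot ⟨hy, h⟩
  simp only [mem_union, mem_setOf_eq]
  rcases (show (0:ℝ) ≤ z (Fin.last 1) from h0).eq_or_lt with h | h
  · exact Or.inl h.symm
  · exact Or.inr (le_antisymm h1 (not_lt.mp fun h' => hnot' ⟨h, h'⟩))

/-! ### the moves -/

/-- Auxiliary step `hUdiff`: h Udiff. [bookkeeping] -/
theorem hUdiff (z : Fin (1 + 1) → ℝ) : DifferentiableAt ℝ (fun w : Fin (1 + 1) → ℝ => u (Fin.init w)) z := by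
  show DifferentiableAt ℝ (fun w : Fin (1 + 1) → ℝ => 1 + w (Fin.castSucc 0)) z
  exact (differentiableAt_const _).add (differentiableAt_apply _ _)

/-- `T1 ≡ A_u` : the affine fibred substitution `t = θ·u`. -/
theorem R3 : KZ.of T1 - KZ.of Au ∈ KZ.relations := by
  have hB : IsSemialgebraic ℚ (KZlog.band G (fun _ => (0:ℝ)) (fun _ => 1)) := band_sa sa_zero sa_one
  refine KZ.of_sub_of_mem_relations_of_fibreMap (a := fun _ => 0) (b := fun _ => 1) (a' := fun _ => 0) (b' := u)
    (fun z => z (Fin.last 1) * u (Fin.init z)) (fun z => u (Fin.init z)) T1 Au rfl rfl (fun _ _ => zero_le_one)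
    ?_ ?_ ?_ ?_ ?_ ?_ ?_
  · show IsSemialgebraicFunOn ℚ (KZlog.band G (fun _ => (0:ℝ)) (fun _ => 1)) _
    exact IsSemialgebraicFunOn.mul_holds (Literature.NumberTheory.Transcendental.isSemialgebraicFunOn_apply hB _)
      (sa_u.comp_init_mono hB band_sub)
  · intro z _
    have hd : DifferentiableAt ℝ (fun w : Fin (1 + 1) → ℝ => w (Fin.last 1) * u (Fin.init w)) z :=
      (differentiableAt_apply (Fin.last 1) z).mul (hUdiff z)
    exact hd
  · intro z _
    have h := (hasDerivAt_id (z (Fin.last 1))).mul_const (u (Fin.init z))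
    rw [one_mul] at h
    refine h.congr_of_eventuallyEq (Filter.Eventually.of_forall fun t => ?_)
    simp only [Fin.snoc_last, Fin.init_snoc, id]
  · intro z hz; exact u_pos hz.1
  · intro y _; simp only [Fin.snoc_last, Fin.init_snoc, zero_mul]
  · intro y _; simp only [Fin.snoc_last, Fin.init_snoc, one_mul]
  · intro z hz
    show f₁ z = gA (Fin.snoc (Fin.init z) (z (Fin.last 1) * u (Fin.init z))) * u (Fin.init z)
    simp only [f₁, gA, Fin.snoc_last, mul_pow]
    ring

/-- `T2 ≡ A_{1/u}` : the affine fibred substitution `t = θ/u`. -/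
theorem R4 : KZ.of T2 - KZ.of Ainv ∈ KZ.relations := by
  have hB : IsSemialgebraic ℚ (KZlog.band G (fun _ => (0:ℝ)) (fun _ => 1)) := band_sa sa_zero sa_one
  refine KZ.of_sub_of_mem_relations_of_fibreMap (a := fun _ => 0) (b := fun _ => 1) (a' := fun _ => 0)
    (b' := fun y => 1 / u y)
    (fun z => z (Fin.last 1) * (1 / u (Fin.init z))) (fun z => 1 / u (Fin.init z)) T2 Ainv rfl rfl
    (fun _ _ => zero_le_one) ?_ ?_ ?_ ?_ ?_ ?_ ?_
  · show IsSemialgebraicFunOn ℚ (KZlog.band G (fun _ => (0:ℝ)) (fun _ => 1)) _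
    exact IsSemialgebraicFunOn.mul_holds (Literature.NumberTheory.Transcendental.isSemialgebraicFunOn_apply hB _)
      (sa_inv_u.comp_init_mono hB band_sub)
  · intro z hz
    have hne : u (Fin.init z) ≠ 0 := (u_pos hz.1).ne'
    have hd : DifferentiableAt ℝ (fun w : Fin (1 + 1) → ℝ => w (Fin.last 1) * (u (Fin.init w))⁻¹) z :=
      (differentiableAt_apply (Fin.last 1) z).mul ((hUdiff z).inv hne)
    simpa only [one_div] using hd
  · intro z _
    have h := (hasDerivAt_id (z (Fin.last 1))).mul_const (1 / u (Fin.init z))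
    rw [one_mul] at h
    refine h.congr_of_eventuallyEq (Filter.Eventually.of_forall fun t => ?_)
    simp only [Fin.snoc_last, Fin.init_snoc, id]
  · intro z hz; have := u_pos hz.1; positivity
  · intro y _; simp only [Fin.snoc_last, Fin.init_snoc, zero_mul]
  · intro y _; simp only [Fin.snoc_last, Fin.init_snoc, one_mul]
  · intro z hz
    show f₂ z = gA (Fin.snoc (Fin.init z) (z (Fin.last 1) * (1 / u (Fin.init z)))) * (1 / u (Fin.init z))
    simp only [f₂, gA, Fin.snoc_last, mul_pow]
    ring

/-- `A_u ≡ A_1 + B` : fibre split at `t = 1`. -/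
theorem R7 : KZ.of Au - KZ.of A1 - KZ.of B ∈ KZ.relations := by
  refine KZ.domainAddRel_subset_relations ⟨1 + 1, Au, A1, B, ?_, ?_, fun _ _ => rfl, fun _ _ => rfl, rfl⟩
  · ext z
    show z ∈ KZlog.band G (fun _ => (0:ℝ)) u ↔ z ∈ KZlog.band G (fun _ => (0:ℝ)) (fun _ => 1) ∪ KZlog.band G (fun _ => (1:ℝ)) u
    simp only [KZlog.mem_band, mem_union]
    constructor
    · rintro ⟨hy, h0, hu⟩
      rcases le_total (z (Fin.last 1)) 1 with h | h
      · exact Or.inl ⟨hy, h0, h⟩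
      · exact Or.inr ⟨hy, h, hu⟩
    · rintro (⟨hy, h0, h1⟩ | ⟨hy, h1, hu⟩)
      · exact ⟨hy, h0, h1.trans (one_lt_u hy).le⟩
      · exact ⟨hy, zero_le_one.trans h1, hu⟩
  · exact measure_mono_null (fun z hz => le_antisymm hz.1.2.2 hz.2.2.1) (KZ.volume_setOf_last_eq_zero (n := 1) 1)

/-- `A_1 ≡ A_{1/u} + B'` : fibre split at `t = 1/u`. -/
theorem R9 : KZ.of A1 - KZ.of Ainv - KZ.of B' ∈ KZ.relations := by
  refine KZ.domainAddRel_subset_relations ⟨1 + 1, A1, Ainv, B', ?_, ?_, fun _ _ => rfl, fun _ _ => rfl, rfl⟩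
  · ext z
    show z ∈ KZlog.band G (fun _ => (0:ℝ)) (fun _ => 1) ↔
      z ∈ KZlog.band G (fun _ => (0:ℝ)) (fun y => 1 / u y) ∪ KZlog.band G (fun y => 1 / u y) (fun _ => 1)
    simp only [KZlog.mem_band, mem_union]
    constructor
    · rintro ⟨hy, h0, h1⟩
      rcases le_total (z (Fin.last 1)) (1 / u (Fin.init z)) with h | h
      · exact Or.inl ⟨hy, h0, h⟩
      · exact Or.inr ⟨hy, h, h1⟩
    · rintro (⟨hy, h0, h1⟩ | ⟨hy, h1, hu⟩)
      · refine ⟨hy, h0, h1.trans ?_⟩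
        have := one_lt_u hy
        rw [div_le_one (by linarith)]; linarith
      · exact ⟨hy, (leinv0 _ hy).trans h1, hu⟩
  · refine measure_mono_null (fun z hz => ?_) (KZ.volume_graph_eq_zero (u := fun y => 1 / u y) sa_inv_u)
    exact ⟨hz.1.1, le_antisymm hz.1.2.2 hz.2.2.1⟩

/-- `B' ≡ B` : the MÖBIUS ROTATION `s ↦ (s + k)/(1 − k s)`, `k = (u−1)/(u+1)`, `[1/u, 1] → [1, u]`. -/
theorem R8 : KZ.of B' - KZ.of B ∈ KZ.relations := by
  have he₁ : ∀ y ∈ G, (1 / u y + k y) / (1 - k y * (1 / u y)) = 1 := by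
    intro y hy
    have hU := u_pos hy; have hU1 := one_lt_u hy
    have hne : u y ≠ 0 := hU.ne'
    have hne1 : u y + 1 ≠ 0 := by positivity
    have hlt : k y * (1 / u y) < 1 := by
      have hk := k_lt_one hy; have hk0 := k_nonneg hy
      have : 1 / u y < 1 := by rw [div_lt_one hU]; exact hU1
      calc k y * (1 / u y) ≤ k y * 1 := by gcongr
        _ < 1 := by linarith
    rw [div_eq_one_iff_eq (by linarith)]
    simp only [k]
    field_simp
    ring
  have he₂ : ∀ y ∈ G, (1 + k y) / (1 - k y * 1) = u y := by
    intro y hy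
    have hU := u_pos hy
    have hne1 : u y + 1 ≠ 0 := by positivity
    have hk := k_lt_one hy
    rw [mul_one, div_eq_iff (by linarith)]
    simp only [k]
    field_simp
    ring
  have hr' : B.domain = KZlog.band G (fun y => (((fun y : Fin 1 → ℝ => 1 / u y) y) + k y) / (1 - k y * (fun y : Fin 1 → ℝ => 1 / u y) y))
      (fun y => (((fun _ : Fin 1 → ℝ => (1:ℝ)) y) + k y) / (1 - k y * (fun _ : Fin 1 → ℝ => (1:ℝ)) y)) := by
    ext z
    show z ∈ KZlog.band G (fun _ => (1:ℝ)) u ↔ _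
    simp only [KZlog.mem_band]
    constructor
    · rintro ⟨hy, h1, h2⟩
      exact ⟨hy, by rw [he₁ _ hy]; exact h1, by rw [he₂ _ hy]; exact h2⟩
    · rintro ⟨hy, h1, h2⟩
      exact ⟨hy, by rw [he₁ _ hy] at h1; exact h1, by rw [he₂ _ hy] at h2; exact h2⟩
  refine of_sub_of_mem_relations_mobius (p := fun _ => (1:ℝ)) (k := k) B' B rfl hr' ?_ sa_k ?_ ?_ rfl rfl
  · intro y hy; have := one_lt_u hy; show 1 / u y ≤ 1; rw [div_le_one (by linarith)]; linarith
  · intro z hz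
    have hne : u (Fin.init z) + 1 ≠ 0 := by have := u_pos hz.1; positivity
    have h : DifferentiableAt ℝ (fun w : Fin (1 + 1) → ℝ => (u (Fin.init w) - 1) * (u (Fin.init w) + 1)⁻¹) z :=
      ((hUdiff z).sub_const 1).mul (((hUdiff z).add_const 1).inv hne)
    simpa only [k, div_eq_mul_inv] using h
  · intro z hz
    have hk1 := k_lt_one hz.1; have hk0 := k_nonneg hz.1
    have ht : z (Fin.last 1) ≤ 1 := hz.2.2
    nlinarith

/-! ### the standing circle test closes -/

/-- **Test §C closes (PROVED): every honest representation of the pure positive circle-kind cylinder integral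
`∫_G ∫₀¹ [u/(1+θ²u²) + u⁻¹/(1+θ²u⁻²) − 2/(1+θ²)] dθ dx` (`u = 1 + x`), whose fibre integral is the angle relation
`arctan u + arctan u⁻¹ − 2 arctan 1 ≡ 0`, is a KZ relation** — by two affine fibred substitutions, two fibre splits
and ONE MÖBIUS ROTATION. The first rung of g13 (`CylKernelZeroCirclePos`). -/
theorem of_mem_relations (V : KZ.IntegralRep (1 + 1)) (hdom : V.domain = box) (hV : EqOn V.integrand FC V.domain) :
    KZ.of V ∈ KZ.relations := by
  set TcR := Tc.restrict box isSemialgebraic_box box_subset with hTcR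
  have R0a : KZ.of Tc - KZ.of TcR ∈ KZ.relations :=
    Tc.of_sub_of_restrict_mem_relations isSemialgebraic_box box_subset volume_Tc_diff_box
  have R0b : KZ.of TcR - KZ.of V ∈ KZ.relations := by
    refine KZ.of_sub_of_mem_relations_of_eqOn (by rw [hdom]; rfl) fun z hz => ?_
    have hz' : z ∈ V.domain := by rw [hdom]; exact hz
    show f₁ z + (f₂ z + f₃ z) = V.integrand z
    rw [hV hz', FC_eq]
  have R1 : KZ.of Tc - KZ.of T1 - KZ.of T23 ∈ KZ.relations :=
    KZ.integrandAddRel_subset_relations ⟨1 + 1, Tc, T1, T23, rfl, rfl, fun _ _ => rfl, rfl⟩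
  have R2 : KZ.of T23 - KZ.of T2 - KZ.of T3 ∈ KZ.relations :=
    KZ.integrandAddRel_subset_relations ⟨1 + 1, T23, T2, T3, rfl, rfl, fun _ _ => rfl, rfl⟩
  have R5 : KZ.of T3 - KZ.of A1neg - KZ.of A1neg ∈ KZ.relations :=
    KZ.integrandAddRel_subset_relations ⟨1 + 1, T3, A1neg, A1neg, rfl, rfl, fun z _ => by
      show f₃ z = gN z + gN z
      simp only [f₃, gN]; ring, rfl⟩
  have R6 : KZ.of A1 + KZ.of A1neg ∈ KZ.relations :=
    KZ.of_add_of_mem_relations_of_eqOn_neg (r := A1) (r' := A1neg) rfl fun z _ => by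
      show gN z = -gA z
      simp only [gN, gA]; ring
  have key : KZ.of V = -(KZ.of Tc - KZ.of TcR) - (KZ.of TcR - KZ.of V) + (KZ.of Tc - KZ.of T1 - KZ.of T23)
      + (KZ.of T23 - KZ.of T2 - KZ.of T3) + (KZ.of T1 - KZ.of Au) + (KZ.of T2 - KZ.of Ainv)
      + (KZ.of T3 - KZ.of A1neg - KZ.of A1neg) + (KZ.of Au - KZ.of A1 - KZ.of B) - (KZ.of B' - KZ.of B)
      - (KZ.of A1 - KZ.of Ainv - KZ.of B') + (KZ.of A1 + KZ.of A1neg) + (KZ.of A1 + KZ.of A1neg) := by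
    abel
  rw [key]
  exact add_mem (add_mem (sub_mem (sub_mem (add_mem (add_mem (add_mem (add_mem (add_mem (add_mem
    (sub_mem (neg_mem R0a) R0b) R1) R2) R3) R4) R5) R7) R8) R9) R6) R6

/-! ### Test §C is an instance of the residual: the fibre identity (the angle relation) -/

/-- `∫₀¹ dθ/(1 + θ² w²) = arctan(w)/w` (`w > 0`). -/
theorem integral_kernel (w : ℝ) (hw : 0 < w) :
    ∫ θ in Ioo (0:ℝ) 1, θ ^ (0:ℕ) / (1 + θ ^ 2 * w ^ 2) = Real.arctan w / w := by
  have h1 : (∫ θ in Ioo (0:ℝ) 1, θ ^ (0:ℕ) / (1 + θ ^ 2 * w ^ 2)) =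
      ∫ θ in (0:ℝ)..1, (fun x : ℝ => (1 + x ^ 2)⁻¹) (θ * w) := by
    rw [intervalIntegral.integral_of_le zero_le_one, integral_Ioc_eq_integral_Ioo]
    refine setIntegral_congr_fun measurableSet_Ioo fun θ _ => ?_
    simp only [pow_zero, mul_pow, one_div]
  rw [h1, intervalIntegral.integral_comp_mul_right (fun x : ℝ => (1 + x ^ 2)⁻¹) hw.ne', zero_mul, one_mul,
    integral_inv_one_add_sq, Real.arctan_zero, sub_zero, smul_eq_mul, div_eq_inv_mul]

/-- **The fibre identity of Test §C** — the last hypothesis of `CylKernelZeroCirclePos` for the test data: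
`u·arctan(u)/u + u⁻¹·(arctan(u⁻¹)/u⁻¹) − 2·(π/4) = 0`, i.e. the angle relation `arctan u + arctan u⁻¹ = π/2`. -/
theorem fibre_identity : ∀ x ∈ G,
    a₀C x + ∑ i, cC i x * ∫ θ in Ioo (0:ℝ) 1, θ ^ MC i / (1 + θ ^ eC i * κC i x) = 0 := by
  intro x hx
  have hU := u_pos hx
  have hU' : 0 < 1 / u x := by positivity
  have h3 : ∫ θ in Ioo (0:ℝ) 1, θ ^ (0:ℕ) / (1 + θ ^ 2 * (1:ℝ)) = Real.pi / 4 := by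
    have h := integral_kernel 1 one_pos
    rw [one_pow, div_one, Real.arctan_one] at h
    exact h
  simp only [Fin.sum_univ_three, a₀C, cC, κC, MC, eC, Matrix.cons_val_zero, Matrix.cons_val_one,
    Matrix.head_cons, Matrix.cons_val_two, Matrix.tail_cons, zero_add]
  rw [integral_kernel (u x) hU, integral_kernel (1 / u x) hU', h3, one_div, Real.arctan_inv_of_pos hU]
  field_simp
  ring

/-! ### Test §C satisfies every hypothesis of the residual `CylKernelZeroCirclePos` -/

end TestC
end Summit.KontsevichZagierPeriods.RootDecompRelativeModAbsolute.Rung30571.RegularisedLogLayer.CylLog.Leaf.G13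
end
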